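import Summits.AtomisticToContinuum.Crystallization.Theorems.PricedLinkCensusStackingHingeSelection
import Summits.AtomisticToContinuum.Crystallization.Theorems.PricedLinkCensusStackingHingeWords

/-!
# Route PricedLinkCensus — word and scale selection by compactness for the hinge `StackingHinge`
(stmt-AtomisticToContinuum-14238)

Steps (b) "ONE stacking word of positive upper density at every window length — König on the
finitely-branching word tree" and (c) "the common scale" of the planner's plan for `StackingHinge`,
in the route's own Barlow vocabulary and WITHOUT any energy argument: if along a sequence of
configurations `x N`, at every window `(R, ε)`, a positive upper density of sites have their
`R`-window two-way `ε`-matched with a rigid image of SOME exact Barlow stacking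
`barlowStacking a c s` — the Hägg word `s` AND the scale `(a, c)` depending on the site, the scale
ranging in a fixed box `[a₁, a₂] × [c₁, c₂]` with `0 < a₁`, `0 < c₁` (for Lennard-Jones ground
states the natural box comes from the uniform bounds on nearest-neighbour distances) — then ONE
scale in the box and ONE Hägg word `s∞` serve all windows: `barlowStacking a c s∞` is charged
with positive upper density at every `(R, ε)` (`exists_chargedWordScale_of_chargedBarlowWindows`).
The selected word need not be periodic.  Two energetic inputs then SUFFICE to carry the two
antecedents of the hinge to its consequent: (a) EXACT BARLOW WINDOWS IN A SCALE BOX (strain `→ 0`)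
and (b₂) PERIODIC WORD SELECTION (Hägg domination) — the hypotheses of the conditional assembly
`stackingHinge_of_barlowWindowsBox_of_wordSelection`.  Caveat on (a): `barlowStacking a c s` has ONE
layer spacing, so (a) presupposes an hcp- or fcc-like charged polytype (relaxed dhcp, 9R, … have
layer-dependent spacings); the relaxation-robust statement is `GroundStatesChargePeriodic` itself.

Proof of the selection theorem: Cantor's intersection theorem in the compact parameter space
`K = (ℤ → Bool) × [a₁, a₂] × [c₁, c₂]` (words coded by Boolean sequences).  Level `k` is the
window `(k + 1, 1/(k + 1))` read with the NORMALISED pattern (stacking origin matched to the site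
itself; every matched stacking can be re-based there, `mem_barlowStacking_iff_sub_mem_shift`).  By
locality (`mem_barlowStacking_of_eqOn`: level `k` inspects only stacking points of norm `≤ k + 4`,
which lie in layers `|m| ≤ L_k`) and the scale perturbation lemma
`dist_barlowPos_le_of_haggLabel_eq`, a site matched at level `k + 1` with parameter `p` is matched
at level `k` with every `p'` whose word agrees with that of `p` on `[-L_k, L_k]` and whose scale is
`δ_k`-close (`hpert`).  Hence the sets `t_k = {p ∈ K | pattern_k(p) has positive upper density}`
satisfy `closure t_{k+1} ⊆ t_k`; each `t_k` is non-empty (re-base, round the scale to a finite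
`δ_k`-net, pigeonhole, `exists_frequently_mul_le_of_sum`); and the closed decreasing sets
`closure t_k` have a common point, good at every level (`rigidCard_of_nat`).  All `[folklore]`.
-/

namespace Summit.AtomisticToContinuum.Crystallization.Theorems

open Summit.AtomisticToContinuum.Crystallization.Theses.PricedLinkCensus
open Literature.MathematicalPhysics.StatisticalMechanics Literature.Geometry.DiscreteGeometry
open Filter Topology

/-! ### §1 Word and scale selection by compactness -/

/-- **One word and one scale for all windows (steps (b) and (c) of the plan, by compactness).**
Let `x N` be finite configurations in `ℝ³` and `[a₁, a₂] × [c₁, c₂]` a box of scales with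
`0 < a₁`, `0 < c₁`.  Suppose that for all `R, ε > 0` there is `ρ > 0` such that for infinitely many
`N` at least `ρ N` sites `i` admit SOME scale `(a, c)` in the box, SOME Hägg word `s` and SOME
rigid motion `g` for which the `R`-window of `x N i` is two-way `ε`-matched with
`g '' barlowStacking a c s`.  Then there are ONE scale `(a, c)` in the box and ONE Hägg word `s∞`
such that `barlowStacking a c s∞` is charged in the same sense at every `(R, ε)`.  Cantor's
intersection theorem in `(ℤ → Bool) × [a₁, a₂] × [c₁, c₂]`; see the module docstring.  The
selected word is in general not periodic. [folklore] -/
theorem exists_chargedWordScale_of_chargedBarlowWindows {a₁ a₂ c₁ c₂ : ℝ} (ha₁ : 0 < a₁)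
    (hc₁ : 0 < c₁) (x : (N : ℕ) → Fin N → EuclideanSpace ℝ (Fin 3))
    (h : ∀ R ε : ℝ, 0 < R → 0 < ε → ∃ ρ : ℝ, 0 < ρ ∧ ∃ᶠ N : ℕ in atTop, ρ * (N : ℝ) ≤
      (Nat.card {i : Fin N // ∃ a ∈ Set.Icc a₁ a₂, ∃ c ∈ Set.Icc c₁ c₂, ∃ s : ℤ → ℤ,
        IsHaggSeq s ∧ ∃ g : EuclideanSpace ℝ (Fin 3) ≃ᵃⁱ[ℝ] EuclideanSpace ℝ (Fin 3),
        (∀ j : Fin N, dist (x N i) (x N j) ≤ R →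
          ∃ z ∈ barlowStacking a c s, dist (x N j) (g z) ≤ ε) ∧
        (∀ z ∈ barlowStacking a c s, dist (x N i) (g z) ≤ R →
          ∃ j : Fin N, dist (x N j) (g z) ≤ ε)} : ℝ)) :
    ∃ a ∈ Set.Icc a₁ a₂, ∃ c ∈ Set.Icc c₁ c₂, ∃ s : ℤ → ℤ, IsHaggSeq s ∧
      ∀ R ε : ℝ, 0 < R → 0 < ε → ∃ ρ : ℝ, 0 < ρ ∧
      ∃ᶠ N : ℕ in atTop, ρ * (N : ℝ) ≤
      (Nat.card {i : Fin N // ∃ g : EuclideanSpace ℝ (Fin 3) ≃ᵃⁱ[ℝ] EuclideanSpace ℝ (Fin 3),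
        (∀ j : Fin N, dist (x N i) (x N j) ≤ R →
          ∃ z ∈ barlowStacking a c s, dist (x N j) (g z) ≤ ε) ∧
        (∀ z ∈ barlowStacking a c s, dist (x N i) (g z) ≤ R →
          ∃ j : Fin N, dist (x N j) (g z) ≤ ε)} : ℝ) := by
  classical
  /- words coded by Boolean sequences -/
  let word : (ℤ → Bool) → ℤ → ℤ := fun b n => if b n then 1 else -1
  have hword : ∀ b, IsHaggSeq (word b) := fun b n => by
    dsimp only [word]; split_ifs <;> simp
  have hword_surj : ∀ s : ℤ → ℤ, IsHaggSeq s → ∃ b, word b = s := fun s hs =>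
    ⟨fun n => decide (s n = 1), funext fun n => by
      rcases hs n with h1 | h1 <;> simp [word, h1]⟩
  /- parameters, the compact box, the normalised pattern and its upper density -/
  let K : Set ((ℤ → Bool) × ℝ × ℝ) := Set.univ ×ˢ (Set.Icc a₁ a₂ ×ˢ Set.Icc c₁ c₂)
  have hKc : IsCompact K := isCompact_univ.prod (isCompact_Icc.prod isCompact_Icc)
  have hKcl : IsClosed K := isClosed_univ.prod (isClosed_Icc.prod isClosed_Icc)
  let NM : ℕ → (ℤ → Bool) × ℝ × ℝ → (N : ℕ) → Fin N → Prop := fun k p N i =>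
    ∃ g : EuclideanSpace ℝ (Fin 3) ≃ᵃⁱ[ℝ] EuclideanSpace ℝ (Fin 3),
    dist (x N i) (g 0) ≤ 1 / (k + 1 : ℝ) ∧
    (∀ j : Fin N, dist (x N i) (x N j) ≤ (k + 1 : ℝ) →
      ∃ z ∈ barlowStacking p.2.1 p.2.2 (word p.1), dist (x N j) (g z) ≤ 1 / (k + 1 : ℝ)) ∧
    (∀ z ∈ barlowStacking p.2.1 p.2.2 (word p.1), dist (x N i) (g z) ≤ (k + 1 : ℝ) →
      ∃ j : Fin N, dist (x N j) (g z) ≤ 1 / (k + 1 : ℝ))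
  let Fat : ℕ → (ℤ → Bool) × ℝ × ℝ → Prop := fun k p =>
    ∃ ρ : ℝ, 0 < ρ ∧ ∃ᶠ N : ℕ in atTop, ρ * (N : ℝ) ≤ (Nat.card {i : Fin N // NM k p N i} : ℝ)
  have hFat_mono : ∀ k k' p p', (∀ N i, NM k p N i → NM k' p' N i) → Fat k p → Fat k' p' := by
    rintro k k' p p' hpp' ⟨ρ, hρ, hfr⟩
    refine ⟨ρ, hρ, hfr.mono fun N hN => hN.trans ?_⟩
    gcongr
    exact Nat.card_le_card_of_injective (Subtype.map id fun i hi => hpp' N i hi)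
      (Subtype.map_injective _ Function.injective_id)
  /- the constants of level `k` -/
  let L : ℕ → ℕ := fun k => ⌈(k + 4 : ℝ) / c₁⌉₊
  have hL : ∀ k : ℕ, (k + 4 : ℝ) ≤ L k * c₁ := fun k => by
    have := Nat.le_ceil ((k + 4 : ℝ) / c₁)
    rwa [div_le_iff₀ hc₁] at this
  let η : ℕ → ℝ := fun k => 1 / (k + 1 : ℝ) - 1 / ((k + 1 : ℕ) + 1 : ℝ)
  have hη : ∀ k, 0 < η k := fun k => by
    show 0 < 1 / (k + 1 : ℝ) - 1 / ((k + 1 : ℕ) + 1 : ℝ)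
    rw [sub_pos]
    exact one_div_lt_one_div_of_lt (by positivity) (by push_cast; linarith)
  have hη1 : ∀ k, η k ≤ 1 := fun k => by
    show 1 / (k + 1 : ℝ) - 1 / ((k + 1 : ℕ) + 1 : ℝ) ≤ 1
    have h1 : 1 / (k + 1 : ℝ) ≤ 1 := by rw [div_le_iff₀ (by positivity)]; linarith
    have h2 : 0 ≤ 1 / ((k + 1 : ℕ) + 1 : ℝ) := by positivity
    linarith
  let δ : ℕ → ℝ := fun k => η k / ((k + 4 : ℝ) * (1 / a₁ + 1 / c₁))
  have hδ : ∀ k, 0 < δ k := fun k => div_pos (hη k) (by positivity)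
  have hδη : ∀ k, δ k * (1 / a₁ + 1 / c₁) * (k + 4 : ℝ) = η k := fun k => by
    show η k / ((k + 4 : ℝ) * (1 / a₁ + 1 / c₁)) * (1 / a₁ + 1 / c₁) * (k + 4 : ℝ) = η k
    field_simp
  /- swapping one parameter for a nearby one moves the inspected stacking points by `≤ η k` -/
  have hswap : ∀ (k : ℕ) (p p' : (ℤ → Bool) × ℝ × ℝ), a₁ ≤ p.2.1 → c₁ ≤ p.2.2 →
      (∀ n : ℤ, -(L k : ℤ) ≤ n → n ≤ L k → p.1 n = p'.1 n) →
      |p.2.1 - p'.2.1| ≤ δ k → |p.2.2 - p'.2.2| ≤ δ k →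
      ∀ z ∈ barlowStacking p.2.1 p.2.2 (word p.1), ‖z‖ ≤ (k + 4 : ℝ) →
        ∃ z' ∈ barlowStacking p'.2.1 p'.2.2 (word p'.1), dist z z' ≤ η k := by
    rintro k ⟨b, a, c⟩ ⟨b', a', c'⟩ ha hc hbb' hda hdc z ⟨m, i, j, rfl⟩ hz
    simp only at ha hc hbb' hda hdc hz ⊢
    have ha0 : 0 < a := ha₁.trans_le ha
    have hc0 : 0 < c := hc₁.trans_le hc
    -- the layer index is at most `L k`
    have hm : |(m : ℝ)| * c ≤ L k * c₁ := by
      have h2' : ‖(barlowPos a c (word b) m i j) 2‖ ≤ ‖barlowPos a c (word b) m i j‖ :=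
        PiLp.norm_apply_le _ 2
      rw [barlowPos_apply_two, Real.norm_eq_abs, abs_mul, abs_of_pos hc0] at h2'
      exact (h2'.trans hz).trans (hL k)
    have hm' : |(m : ℝ)| ≤ L k := by
      have : |(m : ℝ)| * c₁ ≤ |(m : ℝ)| * c := mul_le_mul_of_nonneg_left hc (abs_nonneg _)
      exact le_of_mul_le_mul_right (this.trans hm) hc₁
    rw [abs_le] at hm'
    have hm₁ : -(L k : ℤ) ≤ m := by exact_mod_cast hm'.1
    have hm₂ : m ≤ (L k : ℤ) := by exact_mod_cast hm'.2
    have hlab : haggLabel (word b) m = haggLabel (word b') m :=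
      haggLabel_congr (fun n hn hn' => by simp only [word, hbb' n hn hn']) hm₁ hm₂
    refine ⟨barlowPos a' c' (word b') m i j, barlowPos_mem _ _ _, ?_⟩
    refine (dist_barlowPos_le_of_haggLabel_eq ha0.ne' hc0.ne' hlab i j).trans ?_
    rw [abs_of_pos ha0, abs_of_pos hc0]
    have h1 : |a - a'| / a ≤ δ k * (1 / a₁) := by
      rw [mul_one_div]
      exact div_le_div₀ (hδ k).le hda ha₁ ha
    have h2 : |c - c'| / c ≤ δ k * (1 / c₁) := by
      rw [mul_one_div]
      exact div_le_div₀ (hδ k).le hdc hc₁ hc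
    calc (|a - a'| / a + |c - c'| / c) * ‖barlowPos a c (word b) m i j‖
        ≤ (δ k * (1 / a₁) + δ k * (1 / c₁)) * (k + 4 : ℝ) :=
          mul_le_mul (add_le_add h1 h2) hz (norm_nonneg _)
            (add_nonneg (mul_nonneg (hδ k).le (by positivity))
              (mul_nonneg (hδ k).le (by positivity)))
      _ = η k := by rw [← hδη k]; ring
  /- (P) perturbation: matched at level `k + 1` with `p` ⟹ matched at level `k` with nearby `p'` -/
  have hpert : ∀ (k : ℕ) (p p' : (ℤ → Bool) × ℝ × ℝ), a₁ ≤ p.2.1 → c₁ ≤ p.2.2 →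
      a₁ ≤ p'.2.1 → c₁ ≤ p'.2.2 →
      (∀ n : ℤ, -(L k : ℤ) ≤ n → n ≤ L k → p.1 n = p'.1 n) →
      |p.2.1 - p'.2.1| ≤ δ k → |p.2.2 - p'.2.2| ≤ δ k →
      ∀ N i, NM (k + 1) p N i → NM k p' N i := by
    rintro k p p' ha hc ha' hc' hbb' hda hdc N i ⟨g, h0, h1, h2⟩
    have hbb'' : ∀ n : ℤ, -(L k : ℤ) ≤ n → n ≤ L k → p'.1 n = p.1 n := fun n hn hn' =>
      (hbb' n hn hn').symm
    have hda' : |p'.2.1 - p.2.1| ≤ δ k := by rwa [abs_sub_comm]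
    have hdc' : |p'.2.2 - p.2.2| ≤ δ k := by rwa [abs_sub_comm]
    have hεk : 1 / ((k + 1 : ℕ) + 1 : ℝ) + η k = 1 / (k + 1 : ℝ) := by
      show 1 / ((k + 1 : ℕ) + 1 : ℝ) + (1 / (k + 1 : ℝ) - 1 / ((k + 1 : ℕ) + 1 : ℝ)) = _
      ring
    have hε1 : 1 / ((k + 1 : ℕ) + 1 : ℝ) ≤ 1 := by
      rw [div_le_iff₀ (by positivity)]; push_cast; linarith
    have hRk : ((k + 1 : ℕ) + 1 : ℝ) = (k + 1 : ℝ) + 1 := by push_cast; ring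
    refine ⟨g, h0.trans (by linarith [hη k]), fun j hj => ?_, fun z' hz' hzR => ?_⟩
    · obtain ⟨z, hz, hjz⟩ := h1 j (hj.trans (by rw [hRk]; linarith))
      have hzn : ‖z‖ ≤ (k + 4 : ℝ) := by
        have : ‖z‖ = dist (g z) (g 0) := by rw [g.dist_map, dist_zero_right]
        rw [this]
        calc dist (g z) (g 0) ≤ dist (g z) (x N j) + dist (x N j) (x N i) + dist (x N i) (g 0) :=
              dist_triangle4 _ _ _ _
          _ ≤ 1 + (k + 1 : ℝ) + 1 := by
              have e1 : dist (g z) (x N j) ≤ 1 := by rw [dist_comm]; exact hjz.trans hε1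
              have e2 : dist (x N j) (x N i) ≤ (k + 1 : ℝ) := by rw [dist_comm]; exact hj
              linarith [h0.trans hε1]
          _ ≤ (k + 4 : ℝ) := by linarith
      obtain ⟨z', hz', hzz'⟩ := hswap k p p' ha hc hbb' hda hdc z hz hzn
      refine ⟨z', hz', ?_⟩
      calc dist (x N j) (g z') ≤ dist (x N j) (g z) + dist (g z) (g z') := dist_triangle _ _ _
        _ ≤ 1 / ((k + 1 : ℕ) + 1 : ℝ) + η k := add_le_add hjz (by rwa [g.dist_map])
        _ = 1 / (k + 1 : ℝ) := hεk
    · have hzn : ‖z'‖ ≤ (k + 4 : ℝ) := by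
        have : ‖z'‖ = dist (g z') (g 0) := by rw [g.dist_map, dist_zero_right]
        rw [this]
        calc dist (g z') (g 0) ≤ dist (g z') (x N i) + dist (x N i) (g 0) := dist_triangle _ _ _
          _ ≤ (k + 1 : ℝ) + 1 := by
              rw [dist_comm (g z')]
              exact add_le_add hzR (h0.trans hε1)
          _ ≤ (k + 4 : ℝ) := by linarith
      obtain ⟨z, hz, hzz'⟩ := hswap k p' p ha' hc' hbb'' hda' hdc' z' hz' hzn
      have hzR' : dist (x N i) (g z) ≤ ((k + 1 : ℕ) + 1 : ℝ) := by
        rw [hRk]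
        calc dist (x N i) (g z) ≤ dist (x N i) (g z') + dist (g z') (g z) := dist_triangle _ _ _
          _ ≤ (k + 1 : ℝ) + 1 := add_le_add hzR (by rw [g.dist_map]; exact hzz'.trans (hη1 k))
      obtain ⟨j, hj⟩ := h2 z hz hzR'
      refine ⟨j, ?_⟩
      calc dist (x N j) (g z') ≤ dist (x N j) (g z) + dist (g z) (g z') := dist_triangle _ _ _
        _ ≤ 1 / ((k + 1 : ℕ) + 1 : ℝ) + η k :=
            add_le_add hj (by rw [g.dist_map, dist_comm]; exact hzz')
        _ = 1 / (k + 1 : ℝ) := hεk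
  /- the level sets and their closures -/
  let t : ℕ → Set ((ℤ → Bool) × ℝ × ℝ) := fun k => {p | p ∈ K ∧ Fat k p}
  have ht_anti : ∀ k, t (k + 1) ⊆ t k := by
    rintro k p ⟨hpK, hfat⟩
    have ha : a₁ ≤ p.2.1 := hpK.2.1.1
    have hc : c₁ ≤ p.2.2 := hpK.2.2.1
    exact ⟨hpK, hFat_mono _ _ _ _ (hpert k p p ha hc ha hc (fun _ _ _ => rfl)
      (by simp [(hδ k).le]) (by simp [(hδ k).le])) hfat⟩
  have ht_closure : ∀ k, closure (t (k + 1)) ⊆ t k := by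
    intro k p' hp'
    have hp'K : p' ∈ K := closure_minimal (fun p hp => hp.1) hKcl hp'
    -- an open neighbourhood of `p'` inside which level `k + 1` implies level `k` at `p'`
    let r : (ℤ → Bool) × ℝ × ℝ → (Set.Icc (-(L k : ℤ)) (L k) → Bool) := fun q n => q.1 n.1
    have hr : Continuous r := continuous_pi fun n => (continuous_apply n.1).comp continuous_fst
    let U : Set ((ℤ → Bool) × ℝ × ℝ) := r ⁻¹' {r p'} ∩
      ((fun q => q.2.1) ⁻¹' Metric.ball p'.2.1 (δ k) ∩
        (fun q => q.2.2) ⁻¹' Metric.ball p'.2.2 (δ k))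
    have hU : IsOpen U :=
      ((isOpen_discrete _).preimage hr).inter
        ((Metric.isOpen_ball.preimage (continuous_fst.comp continuous_snd)).inter
          (Metric.isOpen_ball.preimage (continuous_snd.comp continuous_snd)))
    have hp'U : p' ∈ U := ⟨rfl, Metric.mem_ball_self (hδ k), Metric.mem_ball_self (hδ k)⟩
    obtain ⟨p, hpU, hpK, hfat⟩ := mem_closure_iff.1 hp' U hU hp'U
    refine ⟨hp'K, hFat_mono _ _ _ _ (hpert k p p' hpK.2.1.1 hpK.2.2.1 hp'K.2.1.1 hp'K.2.2.1
      (fun n hn hn' => ?_) ?_ ?_) hfat⟩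
    · exact congrFun hpU.1 ⟨n, hn, hn'⟩
    · exact le_of_lt (by simpa [Real.dist_eq] using hpU.2.1)
    · exact le_of_lt (by simpa [Real.dist_eq] using hpU.2.2)
  /- non-emptiness: re-base, round the scale to a finite net, pigeonhole -/
  have ht_ne : ∀ k, (t k).Nonempty := by
    intro k
    -- classes: letter strings on the window × net indices for `a` and `c`
    let M₁ : ℕ := ⌈(a₂ - a₁) / δ k⌉₊
    let M₂ : ℕ := ⌈(c₂ - c₁) / δ k⌉₊
    let cls : (Set.Icc (-(L k : ℤ)) (L k) → Bool) × Fin (M₁ + 1) × Fin (M₂ + 1) →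
        (ℤ → Bool) × ℝ × ℝ := fun w =>
      (fun n => if hn : n ∈ Set.Icc (-(L k : ℤ)) (L k) then w.1 ⟨n, hn⟩ else true,
        a₁ + (w.2.1 : ℕ) * δ k, c₁ + (w.2.2 : ℕ) * δ k)
    obtain ⟨ρ, hρ, hfr⟩ :=
      h ((k + 1 : ℕ) + 1 : ℝ) (1 / ((k + 1 : ℕ) + 1 : ℝ)) (by positivity) (by positivity)
    -- every matched site is normalised-matched at level `k` with some class inside the box
    have hcover : ∀ (N : ℕ) (i : Fin N), (∃ a ∈ Set.Icc a₁ a₂, ∃ c ∈ Set.Icc c₁ c₂,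
        ∃ s : ℤ → ℤ, IsHaggSeq s ∧ ∃ g : EuclideanSpace ℝ (Fin 3) ≃ᵃⁱ[ℝ] EuclideanSpace ℝ (Fin 3),
        (∀ j : Fin N, dist (x N i) (x N j) ≤ ((k + 1 : ℕ) + 1 : ℝ) →
          ∃ z ∈ barlowStacking a c s, dist (x N j) (g z) ≤ 1 / ((k + 1 : ℕ) + 1 : ℝ)) ∧
        (∀ z ∈ barlowStacking a c s, dist (x N i) (g z) ≤ ((k + 1 : ℕ) + 1 : ℝ) →
          ∃ j : Fin N, dist (x N j) (g z) ≤ 1 / ((k + 1 : ℕ) + 1 : ℝ))) →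
        ∃ w, cls w ∈ K ∧ NM k (cls w) N i := by
      rintro N i ⟨a, ha, c, hc, s, hs, g, h1, h2⟩
      obtain ⟨z₀, hz₀, hiz₀⟩ := h1 i (by rw [dist_self]; positivity)
      obtain ⟨m, i₀, j₀, rfl⟩ := hz₀
      obtain ⟨b, hb⟩ := hword_surj _ (isHaggSeq_shift hs m)
      let g' : EuclideanSpace ℝ (Fin 3) ≃ᵃⁱ[ℝ] EuclideanSpace ℝ (Fin 3) :=
        (AffineIsometryEquiv.constVAdd ℝ (EuclideanSpace ℝ (Fin 3))
          (barlowPos a c s m i₀ j₀)).trans g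
      have hg' : ∀ z, g' z = g (barlowPos a c s m i₀ j₀ + z) := fun z => rfl
      have hNM : NM (k + 1) (b, a, c) N i := by
        refine ⟨g', ?_, fun j hj => ?_, fun z hz hzR => ?_⟩
        · rw [hg', add_zero]; exact hiz₀
        · obtain ⟨z, hz, hjz⟩ := h1 j hj
          refine ⟨z - barlowPos a c s m i₀ j₀, ?_, ?_⟩
          · show z - barlowPos a c s m i₀ j₀ ∈ barlowStacking a c (word b)
            rw [hb]; exact (mem_barlowStacking_iff_sub_mem_shift z).1 hz
          · rw [hg', add_sub_cancel]; exact hjz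
        · have hz' : barlowPos a c s m i₀ j₀ + z ∈ barlowStacking a c s := by
            rw [mem_barlowStacking_iff_sub_mem_shift (m := m) (i₀ := i₀) (j₀ := j₀),
              add_sub_cancel_left, ← hb]
            exact hz
          rw [hg'] at hzR ⊢
          exact h2 _ hz' hzR
      obtain ⟨n₁, hn₁, hn₁'⟩ := exists_fin_net_point (hδ k) ha
      obtain ⟨n₂, hn₂, hn₂'⟩ := exists_fin_net_point (hδ k) hc
      have hcls₁ : a₁ ≤ a₁ + (n₁ : ℕ) * δ k :=
        le_add_of_nonneg_right (mul_nonneg (Nat.cast_nonneg _) (hδ k).le)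
      have hcls₂ : c₁ ≤ c₁ + (n₂ : ℕ) * δ k :=
        le_add_of_nonneg_right (mul_nonneg (Nat.cast_nonneg _) (hδ k).le)
      refine ⟨(fun n => b n.1, n₁, n₂), ⟨Set.mem_univ _, ⟨hcls₁, hn₁.trans ha.2⟩,
        ⟨hcls₂, hn₂.trans hc.2⟩⟩, ?_⟩
      refine hpert k (b, a, c) _ ha.1 hc.1 hcls₁ hcls₂ (fun n hn hn' => ?_) ?_ ?_ N i hNM
      · show b n = (if hn : n ∈ Set.Icc (-(L k : ℤ)) (L k) then b n else true)
        rw [dif_pos ⟨hn, hn'⟩]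
      · show |a - (a₁ + (n₁ : ℕ) * δ k)| ≤ δ k
        rw [abs_le]; constructor <;> linarith
      · show |c - (c₁ + (n₂ : ℕ) * δ k)| ≤ δ k
        rw [abs_le]; constructor <;> linarith
    have hfr' : ∃ᶠ N : ℕ in atTop, ρ * (N : ℝ) ≤
        ∑ w, (Nat.card {i : Fin N // cls w ∈ K ∧ NM k (cls w) N i} : ℝ) := by
      refine hfr.mono fun N hN => hN.trans (le_trans ?_
        (natCard_exists_le_sum_natCard (fun w (i : Fin N) => cls w ∈ K ∧ NM k (cls w) N i)))
      gcongr
      exact Nat.card_le_card_of_injective (Subtype.map id fun i hi => hcover N i hi)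
        (Subtype.map_injective _ Function.injective_id)
    obtain ⟨w, -, ρ', hρ', hfr''⟩ := exists_frequently_mul_le_of_sum Finset.univ
      (fun w N => (Nat.card {i : Fin N // cls w ∈ K ∧ NM k (cls w) N i} : ℝ)) hρ hfr'
    -- the selected class is fat at level `k`, and lies in the box
    obtain ⟨N₀, hN₀⟩ : ∃ N : ℕ, ρ' * (N : ℝ) ≤
        (Nat.card {i : Fin N // cls w ∈ K ∧ NM k (cls w) N i} : ℝ) ∧ 0 < N :=
      (hfr''.and_eventually (eventually_gt_atTop 0)).exists
    have hwK : cls w ∈ K := by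
      have hN₀pos : (0 : ℝ) < N₀ := by exact_mod_cast hN₀.2
      have hpos : (0 : ℝ) < Nat.card {i : Fin N₀ // cls w ∈ K ∧ NM k (cls w) N₀ i} :=
        lt_of_lt_of_le (mul_pos hρ' hN₀pos) hN₀.1
      have hne : Nat.card {i : Fin N₀ // cls w ∈ K ∧ NM k (cls w) N₀ i} ≠ 0 := by
        exact_mod_cast hpos.ne'
      obtain ⟨⟨⟨i, hi⟩⟩, -⟩ := Nat.card_ne_zero.1 hne
      exact hi.1
    refine ⟨cls w, hwK, ρ', hρ', hfr''.mono fun N hN => hN.trans ?_⟩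
    gcongr
    exact Nat.card_le_card_of_injective (Subtype.map id fun i hi => hi.2)
      (Subtype.map_injective _ Function.injective_id)
  /- Cantor's intersection theorem for the closures -/
  have hu_anti : ∀ k, closure (t (k + 1)) ⊆ closure (t k) := fun k => closure_mono (ht_anti k)
  have hu0 : IsCompact (closure (t 0)) :=
    hKc.of_isClosed_subset isClosed_closure (closure_minimal (fun p hp => hp.1) hKcl)
  obtain ⟨p, hp⟩ : (⋂ k, closure (t k)).Nonempty :=
    IsCompact.nonempty_iInter_of_sequence_nonempty_isCompact_isClosed _ hu_anti
      (fun k => (ht_ne k).closure) hu0 fun k => isClosed_closure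
  have hpt : ∀ k, p ∈ t k := fun k => ht_closure k (Set.mem_iInter.1 hp (k + 1))
  obtain ⟨hpK, -⟩ := hpt 0
  refine ⟨p.2.1, hpK.2.1, p.2.2, hpK.2.2, word p.1, hword p.1, rigidCard_of_nat x _ fun k => ?_⟩
  obtain ⟨-, ρ, hρ, hfr⟩ := hpt k
  refine ⟨ρ, hρ, hfr.mono fun N hN => hN.trans ?_⟩
  gcongr
  exact Nat.card_le_card_of_injective
    (Subtype.map id fun i hi => by obtain ⟨g, -, h1, h2⟩ := hi; exact ⟨g, h1, h2⟩)
    (Subtype.map_injective _ Function.injective_id)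

/-! ### §2 Conditional assembly: exact Barlow windows in a scale box + periodic word selection -/

/-- **What now separates the antecedents of `StackingHinge` from its consequent (scale-free form).**
The hinge follows from two inputs, both left as hypotheses (they are where energy minimality
enters), the common scale being no longer among them:

* `hEBW` — EXACT BARLOW WINDOWS IN A SCALE BOX ((a) strain `→ 0` of the plan): under the two
  antecedents, along every sequence of Lennard-Jones ground states there is a box of scales
  `[a₁, a₂] × [c₁, c₂]`, `0 < a₁`, `0 < c₁`, such that for every window `(R, ε)` a positive upper
  density of sites have their `R`-window two-way `ε`-matched with a rigid image of SOME exact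
  Barlow stacking `barlowStacking a c s`, the word `s` AND the scale `(a, c)` in the box depending
  on the site and on `N`;
* `hWS` — PERIODIC WORD SELECTION ((b₂), Hägg domination): if one Hägg word is charged at one
  scale `(a, c)`, `0 < a`, `0 < c`, at every window, then some PERIODIC word is charged at some
  scale `(a', c')`, `a' ≠ 0`, `c' ≠ 0`.

One word and one scale for all windows is `exists_chargedWordScale_of_chargedBarlowWindows`
(compactness); the rest is `frequently_gscpCard_of_rigidCard` and
`barlowPeriodicConfiguration_points`. [folklore] -/
theorem stackingHinge_of_barlowWindowsBox_of_wordSelection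
    (hEBW : SoftLayerPropagation → ChargeFreeWindows →
      ∀ x : (N : ℕ) → (Fin N → EuclideanSpace ℝ (Fin 3)),
      (∀ N, IsGroundState lennardJones (x N)) →
      ∃ a₁ a₂ c₁ c₂ : ℝ, 0 < a₁ ∧ 0 < c₁ ∧ ∀ R ε : ℝ, 0 < R → 0 < ε → ∃ ρ : ℝ, 0 < ρ ∧
        ∃ᶠ N : ℕ in atTop, ρ * (N : ℝ) ≤
        (Nat.card {i : Fin N // ∃ a ∈ Set.Icc a₁ a₂, ∃ c ∈ Set.Icc c₁ c₂, ∃ s : ℤ → ℤ,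
          IsHaggSeq s ∧ ∃ g : EuclideanSpace ℝ (Fin 3) ≃ᵃⁱ[ℝ] EuclideanSpace ℝ (Fin 3),
          (∀ j : Fin N, dist (x N i) (x N j) ≤ R →
            ∃ z ∈ barlowStacking a c s, dist (x N j) (g z) ≤ ε) ∧
          (∀ z ∈ barlowStacking a c s, dist (x N i) (g z) ≤ R →
            ∃ j : Fin N, dist (x N j) (g z) ≤ ε)} : ℝ))
    (hWS : ∀ x : (N : ℕ) → (Fin N → EuclideanSpace ℝ (Fin 3)),
      (∀ N, IsGroundState lennardJones (x N)) →
      ∀ (a c : ℝ) (s : ℤ → ℤ), 0 < a → 0 < c → IsHaggSeq s →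
      (∀ R ε : ℝ, 0 < R → 0 < ε → ∃ ρ : ℝ, 0 < ρ ∧ ∃ᶠ N : ℕ in atTop, ρ * (N : ℝ) ≤
        (Nat.card {i : Fin N // ∃ g : EuclideanSpace ℝ (Fin 3) ≃ᵃⁱ[ℝ] EuclideanSpace ℝ (Fin 3),
          (∀ j : Fin N, dist (x N i) (x N j) ≤ R →
            ∃ z ∈ barlowStacking a c s, dist (x N j) (g z) ≤ ε) ∧
          (∀ z ∈ barlowStacking a c s, dist (x N i) (g z) ≤ R →
            ∃ j : Fin N, dist (x N j) (g z) ≤ ε)} : ℝ)) →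
      ∃ (a' c' : ℝ) (p : ℕ) (s' : ℤ → ℤ), a' ≠ 0 ∧ c' ≠ 0 ∧ p ≠ 0 ∧ (∀ m, s' (m + p) = s' m) ∧
        ∀ R ε : ℝ, 0 < R → 0 < ε → ∃ ρ : ℝ, 0 < ρ ∧ ∃ᶠ N : ℕ in atTop, ρ * (N : ℝ) ≤
        (Nat.card {i : Fin N // ∃ g : EuclideanSpace ℝ (Fin 3) ≃ᵃⁱ[ℝ] EuclideanSpace ℝ (Fin 3),
          (∀ j : Fin N, dist (x N i) (x N j) ≤ R →
            ∃ z ∈ barlowStacking a' c' s', dist (x N j) (g z) ≤ ε) ∧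
          (∀ z ∈ barlowStacking a' c' s', dist (x N i) (g z) ≤ R →
            ∃ j : Fin N, dist (x N j) (g z) ≤ ε)} : ℝ)) :
    StackingHinge := by
  intro hSLP hCFW x hx
  obtain ⟨a₁, a₂, c₁, c₂, ha₁, hc₁, h⟩ := hEBW hSLP hCFW x hx
  obtain ⟨a, ha, c, hc, s, hs, hch⟩ := exists_chargedWordScale_of_chargedBarlowWindows ha₁ hc₁ x h
  obtain ⟨a', c', p, s', ha', hc', hp, hs', H⟩ :=
    hWS x hx a c s (ha₁.trans_le ha.1) (hc₁.trans_le hc.1) hs hch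
  refine ⟨barlowPeriodicConfiguration s' ha' hc' hp hs', ?_⟩
  have key := frequently_gscpCard_of_rigidCard x (barlowStacking a' c' s') H
  rw [← barlowPeriodicConfiguration_points s' ha' hc' hp hs'] at key
  exact key

end Summit.AtomisticToContinuum.Crystallization.Theorems
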